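import Literature.AlgebraicGeometry.ShimuraVarieties.UnitaryBallPeterssonRecord
import Literature.AlgebraicGeometry.ShimuraVarieties.UnitaryBallDiscontinuity
import Literature.MeasureTheory.Group.DiscreteSubgroupDomain
import HarnessLib

/-!
# `Δ = ρ_𝔣(Γ)` is a discrete subgroup of `U(2,1)`

KERNEL (registry node D1-G-iii-c, consumer hypothesis of `PeterssonWedgeFormula_of`): for a
compact ball quotient datum `D : UnitaryBallUniformisationDatum 2 X₂` and a Sylvester frame `𝔣`, the image
`D.ballImage 𝔣 = ρ_𝔣(Γ) ≤ U(2,1)` carries the DISCRETE topology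
(`instDiscreteTopologyBallImage`). Proof: by proper discontinuity
(`UnitaryBallDiscontinuity.finite_setOf_smul_mem`, from the arithmeticity of `Γ`) only finitely
many `γ` move the base point `x₀` into a fixed compact neighbourhood `K` of `x₀`; removing the
finitely many images `ρ_𝔣(γ) ≠ 1` from the open set `{g | g · x₀ ∈ interior K}` leaves an open
neighbourhood of `1` in `U(2,1)` meeting `Δ` in `{1}` exactly, and a topological group with `{1}`
open is discrete.
-/

noncomputable section

open MulAction Set Filter Topology
open Literature.Geometry.ComplexHyperbolic
open Literature.Geometry.ComplexHyperbolic.BallModel (U21 Ball x₀)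

namespace Literature.AlgebraicGeometry.ShimuraVarieties

namespace UnitaryBallUniformisationDatum

variable {X₂ : Motives.SchemeOver ℂ} (D : UnitaryBallUniformisationDatum 2 X₂) (𝔣 : D.SylvesterFrame)

/-- **An open neighbourhood of `1` in `U(2,1)` meeting `ρ_𝔣(Γ)` only in `1`.**
[cite: Borel1969, Prop. 7.13] -/
theorem exists_isOpen_inter_ballImage_eq :
    ∃ U : Set U21, IsOpen U ∧ (1 : U21) ∈ U ∧ ∀ δ ∈ D.ballImage 𝔣, δ ∈ U → δ = 1 := by
  obtain ⟨K, hK, hKx⟩ := exists_compact_mem_nhds (x₀ : Ball)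
  have hF : {γ : D.Γ | ∃ z ∈ K, D.ballRep 𝔣 γ • z ∈ K}.Finite := D.finite_setOf_smul_mem 𝔣 hK hK
  set S : Set U21 := (D.ballRep 𝔣) '' {γ : D.Γ | ∃ z ∈ K, D.ballRep 𝔣 γ • z ∈ K} \ {1} with hS_def
  have hS : IsClosed S := ((hF.image _).sdiff).isClosed
  set V : Set U21 := (fun g : U21 ↦ g • x₀) ⁻¹' interior K with hV_def
  have hV : IsOpen V := isOpen_interior.preimage (continuous_id.smul continuous_const)
  refine ⟨V ∩ Sᶜ, hV.inter hS.isOpen_compl, ⟨?_, fun h ↦ h.2 rfl⟩, fun δ hδ hδU ↦ ?_⟩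
  · show (1 : U21) • x₀ ∈ interior K
    rw [one_smul]
    exact mem_interior_iff_mem_nhds.2 hKx
  · obtain ⟨γ, -, hγ⟩ := Subgroup.mem_map.1 hδ
    by_contra hne
    refine hδU.2 ⟨⟨γ, ⟨x₀, mem_of_mem_nhds hKx, ?_⟩, hγ⟩, hne⟩
    rw [hγ]
    exact interior_subset hδU.1

/-- **`ρ_𝔣(Γ)` is discrete in `U(2,1)`.** [cite: Borel1969, Prop. 7.13] -/
instance instDiscreteTopologyBallImage : DiscreteTopology (D.ballImage 𝔣) := by
  obtain ⟨U, hU, h1U, hU1⟩ := D.exists_isOpen_inter_ballImage_eq 𝔣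
  refine discreteTopology_of_isOpen_singleton_one ?_
  have h : ({1} : Set (D.ballImage 𝔣)) = Subtype.val ⁻¹' U := by
    ext δ
    simp only [mem_singleton_iff, mem_preimage]
    constructor
    · rintro rfl
      exact h1U
    · intro hδ
      exact Subtype.ext (hU1 δ.1 δ.2 hδ)
  rw [h]
  exact hU.preimage continuous_subtype_val

/-- Hence `ρ_𝔣(Γ)` is countable. [folklore] -/
instance instCountableBallImage : Countable (D.ballImage 𝔣) :=
  Literature.MeasureTheory.Group.DiscreteSubgroup.countable_of_discrete _

end UnitaryBallUniformisationDatum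

end Literature.AlgebraicGeometry.ShimuraVarieties

end
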